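import Mathlib
import Summits.ValiantsHypothesis.ValiantsHypothesis.Theorems.LacunarySymmetroidMatrixDescartesDefiniteMoments

/-!
# `MatrixDescartes` (stmt-ValiantsHypothesis-18050) — CORANK BOUNDS MULTIPLICITY: `(X − r)^s ∣ det M` whenever `rank M(r) + s ≤ n`

HONEST FRAMING.  Cell `pub-symmetroid`, seat `val-sym-mdr-p2` (gen 15); helper file `--supports` the crux
`Theses.LacunarySymmetroid.MatrixDescartes`, NO closure claim.  A general linear-algebra tool (any square matrix of real
polynomials; for lacunary pencils: `corank F(r) ≤ mult_r det F`), the general form of the census seats' ad-hoc rows («rank ≤ 1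
at a root forces a double root», `…CensusDoorA34RootRank`) and one half of the exact zone count for the intrinsic hyperbolic
sector (`…DefiniteMomentsZones`); nothing here bears on the crux in its window, on `stub_twoSided`, on `DoorA26`/`DoorA34`,
registers, or `VP ≠ VNP`.

THEOREM (`X_sub_C_pow_dvd_det_of_rank`).  `M` an `n × n` matrix over `ℝ[X]`, `r : ℝ`, `s : ℕ` with
`rank (M(r)) + s ≤ card n`.  Then `(X − r)^s ∣ det M`.  PROOF: `M = M(r) + (X − r)·N` entrywise (Taylor); expand `det` by
multilinearity in the rows (`AlternatingMap.map_add_univ`): the term taking the rows of `M(r)` on `u ⊆ n` and of `(X−r)N` off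
`u` is `(X − r)^{#uᶜ}` times a determinant (`map_smul_univ`), and vanishes when `#u > rank M(r)` (those rows of `M(r)` are
linearly dependent, `AlternatingMap.map_linearDependent`); the surviving terms have `#uᶜ ≥ card n − rank ≥ s`.  Corollaries:
`le_rootMultiplicity_det_of_rank` and the pencil form `le_rootMultiplicity_det_pencil_of_rank`
(`corank F(r) ≤ mult_r det F` for `F = ∑ₗ X^{dₗ}Sₗ`). [folklore]; axioms standard; no definitions.
-/

-- layout Summits/ValiantsHypothesis/ValiantsHypothesis forces the duplicated namespace component
set_option linter.dupNamespace false

namespace Summit.ValiantsHypothesis.ValiantsHypothesis.Theorems.LacunarySymmetroidMatrixDescartes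

open Polynomial Matrix Finset
open scoped BigOperators

namespace Multiplicity

variable {n : Type} [Fintype n] [DecidableEq n]

omit [Fintype n] [DecidableEq n] in
/-- **Taylor split at `r`.**  Every square matrix of real polynomials is `M = C(M(r)) + (X − C r)·N` for some polynomial matrix
`N`. [folklore] -/
theorem exists_taylor_split (M : Matrix n n ℝ[X]) (r : ℝ) :
    ∃ N : Matrix n n ℝ[X], M = (M.map (Polynomial.eval r)).map C + (X - C r) • N := by
  refine ⟨fun i j => (M i j - C ((M i j).eval r)) /ₘ (X - C r), Matrix.ext fun i j => ?_⟩
  have hroot : (M i j - C ((M i j).eval r)).IsRoot r := by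
    simp [Polynomial.IsRoot]
  have h := mul_divByMonic_eq_iff_isRoot.2 hroot
  simp only [Matrix.add_apply, Matrix.map_apply, Matrix.smul_apply, smul_eq_mul]
  rw [h]
  ring

/-- **More rows than the rank are dependent** (real matrices): if `#u > rank A` there is a non-trivial real relation among
the rows `A i`, `i ∈ u`, supported on `u`. [folklore] -/
theorem exists_row_relation_of_rank_lt {m : Type} [Fintype m] (A : Matrix n m ℝ) (u : Finset n)
    (hu : A.rank < u.card) :
    ∃ g : n → ℝ, (∀ i, i ∉ u → g i = 0) ∧ (∃ i, g i ≠ 0) ∧ ∑ i, g i • A i = 0 := by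
  classical
  have hdep : ¬ LinearIndependent ℝ (fun i : u => A (i : n)) := by
    intro hli
    have h1 : Module.finrank ℝ (Submodule.span ℝ (Set.range fun i : u => A (i : n))) = u.card := by
      rw [finrank_span_eq_card hli, Fintype.card_coe]
    have h2 : Submodule.span ℝ (Set.range fun i : u => A (i : n)) ≤ Submodule.span ℝ (Set.range A.row) :=
      Submodule.span_mono (by rintro _ ⟨i, rfl⟩; exact ⟨(i : n), rfl⟩)
    have h3 := Submodule.finrank_mono h2
    rw [h1, ← Matrix.rank_eq_finrank_span_row] at h3
    omega
  rw [Fintype.not_linearIndependent_iff] at hdep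
  obtain ⟨g, hg, i₀, hi₀⟩ := hdep
  refine ⟨fun i => if h : i ∈ u then g ⟨i, h⟩ else 0, fun i hi => dif_neg hi, ⟨(i₀ : n), by simp [hi₀]⟩, ?_⟩
  calc ∑ i, (if h : i ∈ u then g ⟨i, h⟩ else 0) • A i
      = ∑ i ∈ u, (if h : i ∈ u then g ⟨i, h⟩ else 0) • A i :=
        (Finset.sum_subset (Finset.subset_univ u) (fun i _ hi => by rw [dif_neg hi, zero_smul])).symm
    _ = ∑ i ∈ u.attach, (if h : (i : n) ∈ u then g ⟨i, h⟩ else 0) • A i := (Finset.sum_attach _ _).symm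
    _ = ∑ i ∈ u.attach, g i • A i := Finset.sum_congr rfl fun i _ => by rw [dif_pos i.2]
    _ = 0 := hg

/-- Lifting a real row relation to the mixed polynomial row family. [folklore] -/
theorem not_linearIndependent_piecewise (A : Matrix n n ℝ) (u : Finset n) (g : n → ℝ)
    (hgu : ∀ i, i ∉ u → g i = 0) (hg0 : ∃ i, g i ≠ 0) (hg : ∑ i, g i • A i = 0) (N : Matrix n n ℝ[X]) :
    ¬ LinearIndependent ℝ[X] (u.piecewise (A.map C) N : n → n → ℝ[X]) := by
  classical
  rw [Fintype.not_linearIndependent_iff]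
  obtain ⟨i₀, hi₀⟩ := hg0
  refine ⟨fun i => C (g i), ?_, ⟨i₀, fun h => hi₀ (C_eq_zero.1 h)⟩⟩
  have hterm : ∀ i : n, C (g i) • (u.piecewise (A.map C) N : n → n → ℝ[X]) i = C (g i) • (A.map C) i := by
    intro i
    by_cases h : i ∈ u
    · rw [Finset.piecewise_eq_of_mem _ _ _ h]
    · rw [hgu i h, C_0, zero_smul, zero_smul]
  rw [Finset.sum_congr rfl fun i _ => hterm i]
  funext j
  have hj := congrFun hg j
  simp only [Finset.sum_apply, Pi.smul_apply, smul_eq_mul, Pi.zero_apply] at hj ⊢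
  simp only [Matrix.map_apply, ← C_mul, ← map_sum C, hj, C_0]

/-- **CORANK BOUNDS MULTIPLICITY.**  For a square matrix `M` of real polynomials and `r : ℝ`: if `rank M(r) + s ≤ card n`
then `(X − C r)^s` divides `det M`. [folklore] -/
theorem X_sub_C_pow_dvd_det_of_rank (M : Matrix n n ℝ[X]) (r : ℝ) (s : ℕ)
    (hrank : (M.map (Polynomial.eval r)).rank + s ≤ Fintype.card n) : (X - C r) ^ s ∣ M.det := by
  classical
  obtain ⟨N, hM⟩ := exists_taylor_split M r
  set A := M.map (Polynomial.eval r) with hA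
  set t : ℝ[X] := X - C r with ht
  -- expand the determinant by multilinearity in the rows
  have hdet : M.det = ∑ u : Finset n, Matrix.detRowAlternating (u.piecewise (A.map C) (t • N)) := by
    rw [hM]
    exact (Matrix.detRowAlternating : (n → ℝ[X]) [⋀^n]→ₗ[ℝ[X]] ℝ[X]).map_add_univ (A.map C) (t • N)
  rw [hdet]
  refine Finset.dvd_sum fun u _ => ?_
  -- pull the factor `t` out of the rows off `u`
  have hpw : (u.piecewise (A.map C) (t • N) : n → n → ℝ[X])
      = fun i => (if i ∈ u then (1 : ℝ[X]) else t) • (u.piecewise (A.map C) N : n → n → ℝ[X]) i := by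
    funext i
    by_cases h : i ∈ u
    · rw [Finset.piecewise_eq_of_mem _ _ _ h, Finset.piecewise_eq_of_mem _ _ _ h, if_pos h, one_smul]
    · rw [Finset.piecewise_eq_of_notMem _ _ _ h, Finset.piecewise_eq_of_notMem _ _ _ h, if_neg h]
      rfl
  rw [hpw, AlternatingMap.map_smul_univ]
  have hprod : (∏ i, (if i ∈ u then (1 : ℝ[X]) else t)) = t ^ (uᶜ).card := by
    rw [← Finset.prod_mul_prod_compl u, Finset.prod_eq_one (fun i hi => if_pos hi), one_mul,
      Finset.prod_congr rfl (fun i hi => if_neg (Finset.mem_compl.1 hi)), Finset.prod_const]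
  rw [hprod, smul_eq_mul]
  by_cases hu : A.rank < u.card
  · -- too many rows of `A`: the determinant factor vanishes
    obtain ⟨g, hgu, hg0, hg⟩ := exists_row_relation_of_rank_lt A u hu
    have hz := AlternatingMap.map_linearDependent (Matrix.detRowAlternating : (n → ℝ[X]) [⋀^n]→ₗ[ℝ[X]] ℝ[X]) _
      (not_linearIndependent_piecewise A u g hgu hg0 hg N)
    rw [hz, mul_zero]
    exact dvd_zero _
  · -- enough rows off `u`
    push Not at hu
    have hcard : s ≤ (uᶜ).card := by
      rw [Finset.card_compl]
      omega
    exact Dvd.dvd.mul_right (pow_dvd_pow t hcard) _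

/-- **Corank ≤ multiplicity.**  With `det M ≠ 0`: `rank M(r) + s ≤ card n` gives `s ≤ mult_r (det M)`. [folklore] -/
theorem le_rootMultiplicity_det_of_rank (M : Matrix n n ℝ[X]) (hM : M.det ≠ 0) (r : ℝ) (s : ℕ)
    (hrank : (M.map (Polynomial.eval r)).rank + s ≤ Fintype.card n) : s ≤ M.det.rootMultiplicity r :=
  (le_rootMultiplicity_iff hM).2 (X_sub_C_pow_dvd_det_of_rank M r s hrank)

/-- **Pencil form.**  For a lacunary pencil `F(X) = ∑ₖ X^{dₖ} Sₖ` with `det F ≠ 0` (as a polynomial) and a scale `r` at which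
`rank F(r) + s ≤ card ι`: `s ≤ mult_r (det F)` — corank bounds multiplicity. [folklore] -/
theorem le_rootMultiplicity_det_pencil_of_rank {ι κ : Type} [Fintype ι] [DecidableEq ι] [Fintype κ] (d : κ → ℕ)
    (S : κ → Matrix ι ι ℝ) (hdet : Matrix.det (∑ k, ((X : ℝ[X]) ^ d k) • (S k).map C) ≠ 0) (r : ℝ) (s : ℕ)
    (hrank : (∑ k, r ^ d k • S k).rank + s ≤ Fintype.card ι) :
    s ≤ (Matrix.det (∑ k, ((X : ℝ[X]) ^ d k) • (S k).map C)).rootMultiplicity r := by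
  refine le_rootMultiplicity_det_of_rank _ hdet r s ?_
  have h : (∑ k, ((X : ℝ[X]) ^ d k) • (S k).map C).map (Polynomial.eval r) = ∑ k, r ^ d k • S k := by
    ext i j
    simp only [Matrix.map_apply, Matrix.sum_apply, Matrix.smul_apply, smul_eq_mul, Polynomial.eval_finsetSum,
      Polynomial.eval_mul, Polynomial.eval_pow, Polynomial.eval_X, Polynomial.eval_C]
  rw [h]
  exact hrank

/-! ## Kernel-vector form (plug-and-play for certificates: exhibit independent kernel vectors at the root) -/

omit [DecidableEq n] in
/-- **Rank–nullity bookkeeping.**  `s` linearly independent real vectors in the kernel of `A` force `rank A + s ≤ card n`.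
[folklore] -/
theorem rank_add_le_of_kernel_family (A : Matrix n n ℝ) {s : ℕ} (v : Fin s → n → ℝ)
    (hv : LinearIndependent ℝ v) (hker : ∀ i, A *ᵥ v i = 0) : A.rank + s ≤ Fintype.card n := by
  have hmem : ∀ i, v i ∈ LinearMap.ker A.mulVecLin := fun i => by
    rw [LinearMap.mem_ker, Matrix.mulVecLin_apply]; exact hker i
  -- the family inside the kernel is still independent
  have hv' : LinearIndependent ℝ (fun i => (⟨v i, hmem i⟩ : LinearMap.ker A.mulVecLin)) := by
    refine LinearIndependent.of_comp (LinearMap.ker A.mulVecLin).subtype ?_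
    exact hv
  have h1 : s ≤ Module.finrank ℝ (LinearMap.ker A.mulVecLin) := by
    simpa using hv'.fintype_card_le_finrank
  have h2 := LinearMap.finrank_range_add_finrank_ker A.mulVecLin
  rw [Module.finrank_fintype_fun_eq_card] at h2
  have h3 : A.rank = Module.finrank ℝ (LinearMap.range A.mulVecLin) := rfl
  omega

/-- **Corank ≤ multiplicity, kernel-vector form.**  For a lacunary pencil `F(X) = ∑ₖ X^{dₖ} Sₖ` with `det F ≠ 0` (as a
polynomial): `s` linearly independent real vectors killed by `F(r)` give `s ≤ mult_r (det F)`. [folklore] -/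
theorem le_rootMultiplicity_det_pencil_of_kernel_family {ι κ : Type} [Fintype ι] [DecidableEq ι] [Fintype κ]
    (d : κ → ℕ) (S : κ → Matrix ι ι ℝ) (hdet : Matrix.det (∑ k, ((X : ℝ[X]) ^ d k) • (S k).map C) ≠ 0) (r : ℝ)
    {s : ℕ} (v : Fin s → ι → ℝ) (hv : LinearIndependent ℝ v) (hker : ∀ i, (∑ k, r ^ d k • S k) *ᵥ v i = 0) :
    s ≤ (Matrix.det (∑ k, ((X : ℝ[X]) ^ d k) • (S k).map C)).rootMultiplicity r :=
  le_rootMultiplicity_det_pencil_of_rank d S hdet r s (rank_add_le_of_kernel_family _ v hv hker)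

/-- **Two non-proportional kernel vectors force a double root** (any format, any real letters; the general form of
`…CensusDoorA34RootRank.two_le_rootMultiplicity_of_adjugate_eq_zero`). [folklore] -/
theorem two_le_rootMultiplicity_det_pencil {ι κ : Type} [Fintype ι] [DecidableEq ι] [Fintype κ]
    (d : κ → ℕ) (S : κ → Matrix ι ι ℝ) (hdet : Matrix.det (∑ k, ((X : ℝ[X]) ^ d k) • (S k).map C) ≠ 0) (r : ℝ)
    (v w : ι → ℝ) (hind : ∀ a b : ℝ, a • v + b • w = 0 → a = 0 ∧ b = 0)
    (hv : (∑ k, r ^ d k • S k) *ᵥ v = 0) (hw : (∑ k, r ^ d k • S k) *ᵥ w = 0) :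
    2 ≤ (Matrix.det (∑ k, ((X : ℝ[X]) ^ d k) • (S k).map C)).rootMultiplicity r := by
  refine le_rootMultiplicity_det_pencil_of_kernel_family d S hdet r ![v, w] ?_ (fun i => ?_)
  · rw [Fintype.linearIndependent_iff]
    intro g hg i
    have h := hind (g 0) (g 1) (by simpa [Fin.sum_univ_two] using hg)
    fin_cases i
    · exact h.1
    · exact h.2
  · fin_cases i
    · exact hv
    · exact hw

end Multiplicity

end Summit.ValiantsHypothesis.ValiantsHypothesis.Theorems.LacunarySymmetroidMatrixDescartes
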